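import Summits.RiemannHypothesis.RiemannHypothesis.Theorems.GroundBartaEvenWinsBeyondArchLatticeRippleTaylor
import HarnessLib

/-!
# RiemannHypothesis / GroundBarta machinery — LATTICE RIPPLES, Taylor-sum cells (2/2): one polynomial per cell

Helper file (`--supports stmt-RiemannHypothesis-18085`; infrastructure for the phantom-ripple moment certificates), RH-free,
axioms standard.  Seat rh-explicit-weil-1.  A cell `[u, v]` of a certified minorant of a lattice cosine sum
`P(t) = Σ_r A_r cos(t x_r)`: ONE rational polynomial `p(h) = Σ_{i<n} p_i h^i`, `h = t − u`, and a slack `ε`, with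

`σ(t) := p(t − u) − ε ≤ P(t)` on the cell,

checked in the kernel from the per-ripple two-sided claims of `XRip` (file 1/2): the true Taylor coefficients
`C_i = Σ_r termReal_r(i)` lie in the rational intervals `[Σ termLo, Σ termHi]`, so
`P(u+h) − p(h) ≥ −Σ_i max(|coefLo_i − p_i|, |coefHi_i − p_i|) w^i − Σ_r remB_r` (`w = v − u`), and the checker demands
`ε ≥` that quantity.  The polynomial is STORED in the global variable `s` (`dcoeffs`: `p(s − u) = Σ_l d_l s^l`), so that its
moments are `Σ_l d_l ∫ s^{l+q}` (one power integral per coefficient — the moment facts are the dominant kernel cost of a chain);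
the Taylor coefficients `p_i = Σ_l d_l C(l,i) u^{l−i}` used by the checker are recomputed exactly (`pcoef`).  Interface identical to the per-ripple cells `XCell` of `…LatticeRippleCells.lean` (`sigma`, `rippleSum`,
`ripples`, `checkZ`, `sigma_le_Z`, `absQ`, `momentQ`, `Valid`), so the chain layer is a verbatim copy; the point of this variant
is cost: one low-degree polynomial per (wide) cell instead of one bracket polynomial per ripple per (narrow) cell.
Everything here is proved; no named facts.
-/

set_option linter.dupNamespace false

noncomputable section

open Complex Finset MeasureTheory Set Filter
open scoped Real Topology BigOperators

namespace Summit.RiemannHypothesis.RiemannHypothesis.Theorems.EvenWinsBeyondArch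

open Literature.NumberTheory.LFunctions
open Literature.Analysis.ValidatedNumerics.Numerics
open Literature.Analysis.SpecialFunctions

/-- A Taylor-sum cell: the interval `[u, v]`, the Taylor order `n`, the claimed polynomial coefficients (in `h = t − u`, length
`≤ n`), the slack `ε`, and one `XRip` (ripple with two-sided claims at `u`) per phantom ripple. [folklore] -/
structure XTCell where
  /-- left end point -/
  u : ℚ
  /-- right end point -/
  v : ℚ
  /-- Taylor order (remainder degree) -/
  n : ℕ
  /-- coefficients `d_0, …` of the cell polynomial in the GLOBAL variable (`Σ_l d_l t^l = p(t − u)`) -/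
  dcoeffs : List ℚ
  /-- the certified slack -/
  eps : ℚ
  /-- the ripples with their cell-local claims -/
  claims : List XRip

namespace XTCell

variable (c : XTCell)

/-- The ripple data `(j, k, A)` of the cell. [folklore] -/
def ripples : List (ℤ × ℤ × ℚ) := c.claims.map fun r ↦ (r.j, r.k, r.A)

/-- The cosine sum the cell minorises: `Σ_r A_r cos(t x_r)`. [folklore] -/
def rippleSum (t : ℝ) : ℝ := (c.claims.map fun r ↦ r.val t).sum

/-- The cell function `σ(t) = Σ_l d_l t^l − ε`. [folklore] -/
def sigma (t : ℝ) : ℝ := polyR c.dcoeffs t - c.eps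

/-- The Taylor coefficient at `u` of order `i` of the cell polynomial: `p_i = Σ_l d_l C(l,i) u^{l−i}`. [folklore] -/
def pcoef (i : ℕ) : ℚ := sumR c.dcoeffs.length fun l ↦ getV c.dcoeffs l * ((l.choose i : ℕ) : ℚ) * c.u ^ (l - i)

/-- Lower end of the true Taylor coefficient `C_i = Σ_r termReal_r(i)`. [folklore] -/
def coefLo (i : ℕ) : ℚ := (c.claims.map fun r ↦ r.termLo i).sum

/-- Upper end of the true Taylor coefficient. [folklore] -/
def coefHi (i : ℕ) : ℚ := (c.claims.map fun r ↦ r.termHi i).sum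

/-- The coefficient mismatch price `Σ_{i<n} max(|coefLo_i − p_i|, |coefHi_i − p_i|) w^i`. [folklore] -/
def coefPrice : ℚ :=
  sumR c.n fun i ↦ max |c.coefLo i - c.pcoef i| |c.coefHi i - c.pcoef i| * (c.v - c.u) ^ i

/-- The total remainder `Σ_r remB_r(w, n)`. [folklore] -/
def remTot : ℚ := (c.claims.map fun r ↦ r.remB (c.v - c.u) c.n).sum

/-- **The integer checker**: `0 ≤ u < v`, `dcoeffs.length ≤ n`, every ripple checks at `u` with `xhi·w·2 ≤ n+1`, and
`ε ≥ coefPrice + remTot`. [folklore] -/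
def checkZ : Bool :=
  decide (0 ≤ c.u) && decide (c.u < c.v) && decide (c.dcoeffs.length ≤ c.n) &&
    c.claims.all (fun r ↦ r.check c.u && decide (r.xhi * (c.v - c.u) * 2 ≤ (c.n : ℚ) + 1)) &&
    decide (c.coefPrice + c.remTot ≤ c.eps)

variable {c}

/-- Unpacking `checkZ`. [folklore] -/
theorem checkZ_spec (h : c.checkZ = true) :
    0 ≤ c.u ∧ c.u < c.v ∧ c.dcoeffs.length ≤ c.n ∧
      (∀ r ∈ c.claims, r.check c.u = true ∧ r.xhi * (c.v - c.u) * 2 ≤ (c.n : ℚ) + 1) ∧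
      c.coefPrice + c.remTot ≤ c.eps := by
  unfold checkZ at h
  simp only [Bool.and_eq_true, decide_eq_true_eq, List.all_eq_true] at h
  exact ⟨h.1.1.1.1, h.1.1.1.2, h.1.1.2, h.1.2, h.2⟩

/-! ### Soundness -/

/-- The true Taylor coefficient `C_i` of the cell's ripple list. [folklore] -/
def coefReal (l : List XRip) (u : ℚ) (i : ℕ) : ℝ := (l.map fun r ↦ r.termReal u i).sum

/-- Cast of a rational list sum. [folklore] -/
theorem cast_sum_map (l : List XRip) (f : XRip → ℚ) :
    (((l.map f).sum : ℚ) : ℝ) = (l.map fun r ↦ ((f r : ℚ) : ℝ)).sum := by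
  induction l with
  | nil => simp
  | cons r rs ih => rw [List.map_cons, List.sum_cons, List.map_cons, List.sum_cons, Rat.cast_add, ih]

/-- The ripple sum of a list expands with coefficients `coefReal` and total remainder `Σ remB`. [folklore] -/
theorem rippleList_expansion (l : List XRip) {u w : ℚ} {n : ℕ}
    (hl : ∀ r ∈ l, r.check u = true ∧ r.xhi * w * 2 ≤ (n : ℚ) + 1) {hh : ℝ} (hh0 : 0 ≤ hh) (hhw : hh ≤ (w : ℝ)) :
    |(l.map fun r ↦ r.val ((u : ℝ) + hh)).sum - ∑ i ∈ Finset.range n, coefReal l u i * hh ^ i| ≤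
      (l.map fun r ↦ ((r.remB w n : ℚ) : ℝ)).sum := by
  induction l with
  | nil => simp [coefReal]
  | cons r rs ih =>
    have hr := hl r (by simp)
    have ih' := ih fun r' hr' ↦ hl r' (by simp [hr'])
    have h1 := XRip.abs_val_sub_sum_le hr.1 hr.2 hh0 hhw
    simp only [List.map_cons, List.sum_cons]
    have e : r.val ((u : ℝ) + hh) + (rs.map fun r ↦ r.val ((u : ℝ) + hh)).sum -
        ∑ i ∈ Finset.range n, coefReal (r :: rs) u i * hh ^ i =
        (r.val ((u : ℝ) + hh) - ∑ i ∈ Finset.range n, r.termReal u i * hh ^ i) +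
          ((rs.map fun r ↦ r.val ((u : ℝ) + hh)).sum - ∑ i ∈ Finset.range n, coefReal rs u i * hh ^ i) := by
      have : ∀ i, coefReal (r :: rs) u i = r.termReal u i + coefReal rs u i := fun i ↦ by
        simp [coefReal]
      simp_rw [this, add_mul, Finset.sum_add_distrib]
      ring
    rw [e]
    exact (abs_add_le _ _).trans (add_le_add h1 ih')

/-- The true coefficients lie in `[coefLo, coefHi]`. [folklore] -/
theorem coefReal_mem {l : List XRip} {u : ℚ} (hl : ∀ r ∈ l, r.check u = true) (i : ℕ) :
    (l.map fun r ↦ ((r.termLo i : ℚ) : ℝ)).sum ≤ coefReal l u i ∧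
      coefReal l u i ≤ (l.map fun r ↦ ((r.termHi i : ℚ) : ℝ)).sum := by
  induction l with
  | nil => simp [coefReal]
  | cons r rs ih =>
    have h1 := XRip.term_mem (hl r (by simp)) i
    have ih' := ih fun r' hr' ↦ hl r' (by simp [hr'])
    simp only [List.map_cons, List.sum_cons, coefReal] at *
    exact ⟨add_le_add h1.1 ih'.1, add_le_add h1.2 ih'.2⟩

/-- **Re-expansion at `u`**: `Σ_l d_l (u + h)^l = Σ_{i<n} p_i h^i` with `p_i = Σ_l d_l C(l,i) u^{l−i}`, for `d.length ≤ n`. [folklore] -/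
theorem polyR_taylor (c : XTCell) {n : ℕ} (hn : c.dcoeffs.length ≤ n) (h : ℝ) :
    polyR c.dcoeffs ((c.u : ℝ) + h) = ∑ i ∈ Finset.range n, ((c.pcoef i : ℚ) : ℝ) * h ^ i := by
  unfold polyR pcoef
  simp_rw [sumR_eq_sum]
  push_cast
  -- expand (u+h)^l = Σ_{i ≤ l} h^i u^{l-i} C(l,i), extended to i < n
  have hexp : ∀ l ∈ Finset.range c.dcoeffs.length, ((getV c.dcoeffs l : ℚ) : ℝ) * ((c.u : ℝ) + h) ^ l =
      ∑ i ∈ Finset.range n, ((getV c.dcoeffs l : ℚ) : ℝ) * ((l.choose i : ℕ) : ℝ) * (c.u : ℝ) ^ (l - i) * h ^ i := by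
    intro l hl
    have hl' : l < n := lt_of_lt_of_le (Finset.mem_range.1 hl) hn
    rw [add_comm, add_pow, Finset.mul_sum]
    -- extend the range from l+1 to n
    rw [← Finset.sum_subset (Finset.range_subset_range.2 (show l + 1 ≤ n by omega))]
    · refine Finset.sum_congr rfl fun i _ ↦ ?_
      ring
    · intro i _ hi
      have hli : l < i := by simpa using hi
      rw [Nat.choose_eq_zero_of_lt hli]
      simp
  rw [Finset.sum_congr rfl hexp, Finset.sum_comm]
  refine Finset.sum_congr rfl fun i _ ↦ ?_
  rw [Finset.sum_mul]

/-- `p_i = 0` beyond the length of the coefficient list. [folklore] -/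
theorem pcoef_eq_zero {c : XTCell} {i : ℕ} (hi : c.dcoeffs.length ≤ i) : c.pcoef i = 0 := by
  unfold pcoef
  rw [sumR_eq_sum]
  refine Finset.sum_eq_zero fun l hl ↦ ?_
  have : l < i := lt_of_lt_of_le (Finset.mem_range.1 hl) hi
  rw [Nat.choose_eq_zero_of_lt this]
  simp

/-- **Cell soundness (integer checker), Taylor-sum cell.** On its cell, `Σ_l d_l t^l − ε ≤ Σ_r A_r cos(t x_r)` (`= σ(t) ≤ P(t)`). [folklore] -/
theorem poly_sub_eps_le_rippleSum (h : c.checkZ = true) {t : ℝ} (hut : (c.u : ℝ) ≤ t) (htv : t ≤ (c.v : ℝ)) :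
    polyR c.dcoeffs t - (c.eps : ℝ) ≤ c.rippleSum t := by
  obtain ⟨hu0, huv, hlen, hall, heps⟩ := checkZ_spec h
  set hh : ℝ := t - c.u with hhdef
  have hh0 : 0 ≤ hh := by rw [hhdef]; linarith
  have hhw : hh ≤ ((c.v - c.u : ℚ) : ℝ) := by push_cast; rw [hhdef]; linarith
  have ht : t = (c.u : ℝ) + hh := by rw [hhdef]; ring
  have hexp := rippleList_expansion c.claims hall hh0 hhw
  have hco := fun i ↦ coefReal_mem (fun r hr ↦ (hall r hr).1) i (l := c.claims) (u := c.u)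
  have hpoly : polyR c.dcoeffs t = ∑ i ∈ Finset.range c.n, ((c.pcoef i : ℚ) : ℝ) * hh ^ i := by
    rw [ht]; exact polyR_taylor c hlen hh
  -- coefficient mismatch
  have hmis : ∑ i ∈ Finset.range c.n, coefReal c.claims c.u i * hh ^ i - ∑ i ∈ Finset.range c.n, ((c.pcoef i : ℚ) : ℝ) * hh ^ i
      ≥ -((c.coefPrice : ℚ) : ℝ) := by
    unfold coefPrice
    rw [sumR_eq_sum, ← Finset.sum_sub_distrib]
    push_cast
    rw [← Finset.sum_neg_distrib]
    refine Finset.sum_le_sum fun i _ ↦ ?_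
    have hhi : hh ^ i ≤ ((c.v : ℝ) - c.u) ^ i := pow_le_pow_left₀ hh0 (by push_cast at hhw; exact hhw) i
    have hhi0 : 0 ≤ hh ^ i := pow_nonneg hh0 i
    have hc := hco i
    have hLo : ((c.coefLo i : ℚ) : ℝ) ≤ coefReal c.claims c.u i := by
      unfold coefLo; rw [cast_sum_map]; exact hc.1
    have hHi : coefReal c.claims c.u i ≤ ((c.coefHi i : ℚ) : ℝ) := by
      unfold coefHi; rw [cast_sum_map]; exact hc.2
    have hdiff : |coefReal c.claims c.u i - ((c.pcoef i : ℚ) : ℝ)| ≤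
        ((max |c.coefLo i - c.pcoef i| |c.coefHi i - c.pcoef i| : ℚ) : ℝ) := by
      push_cast
      rw [abs_le]
      constructor
      · have h3 := le_max_left |((c.coefLo i : ℚ) : ℝ) - ((c.pcoef i : ℚ) : ℝ)| |((c.coefHi i : ℚ) : ℝ) - ((c.pcoef i : ℚ) : ℝ)|
        have h2 := neg_abs_le (((c.coefLo i : ℚ) : ℝ) - ((c.pcoef i : ℚ) : ℝ))
        linarith
      · have h3 := le_max_right |((c.coefLo i : ℚ) : ℝ) - ((c.pcoef i : ℚ) : ℝ)| |((c.coefHi i : ℚ) : ℝ) - ((c.pcoef i : ℚ) : ℝ)|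
        have h2 := le_abs_self (((c.coefHi i : ℚ) : ℝ) - ((c.pcoef i : ℚ) : ℝ))
        linarith
    have hprod : |(coefReal c.claims c.u i - ((c.pcoef i : ℚ) : ℝ)) * hh ^ i| ≤
        ((max |c.coefLo i - c.pcoef i| |c.coefHi i - c.pcoef i| : ℚ) : ℝ) * ((c.v : ℝ) - c.u) ^ i := by
      rw [abs_mul, abs_of_nonneg hhi0]
      exact mul_le_mul hdiff hhi hhi0 (le_trans (abs_nonneg _) hdiff)
    have := neg_abs_le ((coefReal c.claims c.u i - ((c.pcoef i : ℚ) : ℝ)) * hh ^ i)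
    push_cast at hprod ⊢
    nlinarith
  -- assemble
  unfold rippleSum
  rw [hpoly, ht]
  have hexp' := (abs_le.1 hexp).1
  have heps' : ((c.coefPrice : ℚ) : ℝ) + ((c.remTot : ℚ) : ℝ) ≤ (c.eps : ℝ) := by exact_mod_cast heps
  have hrem : ((c.remTot : ℚ) : ℝ) = (c.claims.map fun r ↦ ((r.remB (c.v - c.u) c.n : ℚ) : ℝ)).sum := by
    unfold remTot; rw [cast_sum_map]
  rw [hrem] at heps'
  linarith

/-! ### Sup bound, continuity, moments -/

/-- `Σ_{i<n} |p_i| w^i + |ε|`, an upper bound of `|σ|` on the cell (in the Taylor basis at `u`). [folklore] -/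
def absQ : ℚ := (sumR c.n fun i ↦ |c.pcoef i| * (c.v - c.u) ^ i) + |c.eps|

/-- **Sup bound** (needs `dcoeffs.length ≤ n`): `|σ(t)| ≤ absQ` for `u ≤ t ≤ v`. [folklore] -/
theorem abs_sigma_le_of (hlen : c.dcoeffs.length ≤ c.n) {t : ℝ} (hut : (c.u : ℝ) ≤ t) (htv : t ≤ (c.v : ℝ)) :
    |c.sigma t| ≤ ((c.absQ : ℚ) : ℝ) := by
  have ht : t = (c.u : ℝ) + (t - c.u) := by ring
  have hpoly : polyR c.dcoeffs t = ∑ i ∈ Finset.range c.n, ((c.pcoef i : ℚ) : ℝ) * (t - c.u) ^ i := by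
    rw [ht]; simpa using polyR_taylor c hlen (t - c.u)
  have h0 : 0 ≤ t - c.u := by linarith
  have hw : t - c.u ≤ (c.v : ℝ) - c.u := by linarith
  unfold sigma absQ
  rw [hpoly, sumR_eq_sum]
  push_cast
  refine (abs_sub _ _).trans (add_le_add ?_ le_rfl)
  refine (Finset.abs_sum_le_sum_abs _ _).trans (Finset.sum_le_sum fun i _ ↦ ?_)
  rw [abs_mul, abs_pow, abs_of_nonneg h0]
  exact mul_le_mul_of_nonneg_left (pow_le_pow_left₀ h0 hw i) (abs_nonneg _)

/-- `0 ≤ absQ` for a Taylor-sum cell with `u < v`. [folklore] -/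
theorem absQ_nonneg_of_lt (huv : c.u < c.v) : 0 ≤ c.absQ := by
  unfold absQ
  rw [sumR_eq_sum]
  have hw : 0 ≤ c.v - c.u := by linarith
  exact add_nonneg (Finset.sum_nonneg fun i _ ↦ mul_nonneg (abs_nonneg _) (pow_nonneg hw _)) (abs_nonneg _)

/-- Continuity of the cell function. [folklore] -/
theorem continuous_sigma (c : XTCell) : Continuous c.sigma := by
  unfold sigma polyR; fun_prop

/-- Continuity of the ripple sum. [folklore] -/
theorem continuous_rippleSum (c : XTCell) : Continuous c.rippleSum := by
  unfold rippleSum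
  induction c.claims with
  | nil => simpa using continuous_const
  | cons r rs ih =>
    simp only [List.map_cons, List.sum_cons]
    refine Continuous.add ?_ ih
    unfold XRip.val
    fun_prop

/-- `(v^e − u^e)/e`. [folklore] -/
def powIntQ (c : XTCell) (e : ℕ) : ℚ := (c.v ^ e - c.u ^ e) / e

/-- `∫_u^v s^e ds = powIntQ (e+1)`. [folklore] -/
theorem integral_pow_eq_powIntQ (c : XTCell) (e : ℕ) : ∫ s in (c.u : ℝ)..c.v, s ^ e = (c.powIntQ (e + 1) : ℝ) := by
  rw [integral_pow, powIntQ]; push_cast; ring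

/-- `∫_u^v σ(s) s^q ds` in closed form: `Σ_l d_l ∫ s^{l+q} − ε ∫ s^q` (ONE power integral per coefficient). [folklore] -/
def momentQ (c : XTCell) (q : ℕ) : ℚ :=
  (sumR c.dcoeffs.length fun l ↦ getV c.dcoeffs l * c.powIntQ (l + q + 1)) - c.eps * c.powIntQ (q + 1)

/-- **Cell moments.** `∫_u^v σ(s) s^q ds = momentQ q`. [folklore] -/
theorem integral_sigma_mul_pow (c : XTCell) (q : ℕ) :
    ∫ s in (c.u : ℝ)..c.v, c.sigma s * s ^ q = (c.momentQ q : ℝ) := by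
  have hpt : ∀ s : ℝ, c.sigma s * s ^ q =
      (∑ l ∈ Finset.range c.dcoeffs.length, ((getV c.dcoeffs l : ℚ) : ℝ) * s ^ (l + q)) - (c.eps : ℝ) * s ^ q := by
    intro s
    unfold sigma polyR
    rw [sub_mul, Finset.sum_mul]
    congr 1
    exact Finset.sum_congr rfl fun l _ ↦ by rw [pow_add]; ring
  simp_rw [hpt]
  have iK : ∀ l, IntervalIntegrable (fun s : ℝ ↦ ((getV c.dcoeffs l : ℚ) : ℝ) * s ^ (l + q)) volume c.u c.v :=
    fun l ↦ (continuous_const.mul (continuous_pow _)).intervalIntegrable _ _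
  have iS : IntervalIntegrable (fun s : ℝ ↦ ∑ l ∈ Finset.range c.dcoeffs.length,
      ((getV c.dcoeffs l : ℚ) : ℝ) * s ^ (l + q)) volume c.u c.v :=
    (continuous_finsetSum _ fun l _ ↦ continuous_const.mul (continuous_pow _)).intervalIntegrable _ _
  have iE : IntervalIntegrable (fun s : ℝ ↦ (c.eps : ℝ) * s ^ q) volume c.u c.v :=
    (continuous_const.mul (continuous_pow q)).intervalIntegrable _ _
  rw [intervalIntegral.integral_sub iS iE, intervalIntegral.integral_finsetSum fun l _ ↦ iK l,
    intervalIntegral.integral_const_mul, integral_pow_eq_powIntQ]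
  unfold momentQ
  rw [sumR_eq_sum]
  push_cast
  congr 1
  refine Finset.sum_congr rfl fun l _ ↦ ?_
  rw [intervalIntegral.integral_const_mul, integral_pow_eq_powIntQ]

/-! ### Valid cells -/

/-- What the chain layer uses about a cell. [folklore] -/
structure Valid (c : XTCell) : Prop where
  /-- `0 ≤ u` -/
  u_nonneg : 0 ≤ c.u
  /-- `u < v` -/
  u_lt_v : c.u < c.v
  /-- `σ ≤ Σ_r A_r cos(t x_r)` on the cell -/
  sigma_le : ∀ t : ℝ, (c.u : ℝ) ≤ t → t ≤ c.v → c.sigma t ≤ c.rippleSum t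
  /-- `|σ| ≤ absQ` on the cell -/
  abs_le : ∀ t : ℝ, (c.u : ℝ) ≤ t → t ≤ c.v → |c.sigma t| ≤ c.absQ
  /-- `0 ≤ absQ` -/
  absQ_nonneg : 0 ≤ c.absQ

/-- An integer-checked Taylor-sum cell is valid, and its coefficient list is no longer than its order. [folklore] -/
theorem valid_of_checkZ (h : c.checkZ = true) : c.Valid ∧ c.dcoeffs.length ≤ c.n := by
  obtain ⟨hu, huv, hlen, -, -⟩ := checkZ_spec h
  exact ⟨⟨hu, huv, fun _t hut htv ↦ poly_sub_eps_le_rippleSum h hut htv, fun _t hut htv ↦ abs_sigma_le_of hlen hut htv,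
    absQ_nonneg_of_lt huv⟩, hlen⟩

end XTCell

end Summit.RiemannHypothesis.RiemannHypothesis.Theorems.EvenWinsBeyondArch

end
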